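import Summits.CriticalPhenomena.PercolationContinuityZ3.Theorems.Transplant.FKDoubleFanMultifanCone
import Summits.CriticalPhenomena.PercolationContinuityZ3.Theorems.Transplant.FKDoubleFanOneSidedConeSDeg
import HarnessLib

/-!
# Double fans `K₂ ∨ P_{m+1}`: the SET-LEVEL (single-atom) reduction of the far cross-apex theorem — letter-stable SETS of bivectors,
# the atom set of positive multiples of MULTIFAN₁ images with WEAK legs, and `HypSet ⟹` negative correlation for every middle

Helper file (`--supports stmt-CriticalPhenomena-4575`), FK sub-lane `prim-bschramm-fk-3` (gen 45); builds on p205010 (kernel theorem, internal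
audit signed; external expert review pending).  No named facts, no sorries; standard axioms.  Memo `bschramm/prim-bschramm-fk-3/FAR-CROSS-XX.md`.

`…MultifanCone` reduces the far cross-apex theorem to the CONE-level statement `HypAC` (an `a`-spoke maps MULTIFAN₁ images into the closed convex
cone they generate).  The invariant-cone principle never used convexity: `rayleigh_of_isOpCone` (`…DoubleFanWedge`) needs only a SET of bivectors
containing the input, mapped into itself by the three whole letters, and pairing `≥ 0` with the target.  This file records that weaker principle
(**`IsLetterStable`**, **`IsLetterStable.wedgeH_midWord_mem`**, **`rayleigh_crossFar_of_isLetterStable`**) and instantiates it with the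
non-convex **`mfAtomSet q`** of non-negative multiples `c • imgAB q F G u` of MULTIFAN₁ images whose legs lie in the WEAK classes actually used by
`mfRay_nonneg_of_goodIJ` (`…MultifanGood`): `F` with masses `≥ 0` and `(U_c)` (**`LegF`**), `G ∈ InS q` (`…OneSidedConeS`; closed under `b`-spokes
and rim steps, which are absorbed into `G` by `opBC_imgAB` / `opE_imgAB`), `u` with masses `≥ 0` and `(U_b)` (**`LegU`**).  Targets pair `≥ 0` with
every atom (**`pairH_mfAtomSet_target`**, `0 < q < 1`), inputs are atoms (**`input_mem_mfAtomSet`**), so under the single SET-LEVEL hypothesis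
**`HypSet q`** — `∧²AC_x` maps every atom to an atom: the oriented plane `AC_x·G_b F_a·span(u, P_a u)` IS a MULTIFAN₁ plane `G'_b F'_a·span(u', P_a u')`
with legs in the same classes — the atom set is letter-stable (**`isLetterStable_mfAtomSet`**) and every cross-apex pair of every weighted double fan
is negatively correlated at every distance (**`rayleigh_crossFar_of_hypSet`**, **`negCorr_spokes_cross_far_of_hypSet`**), with NO cone, bi-dual or
compactness argument.  STATUS of `HypSet`: OPEN; numerically it holds in every tested instance (memo §2: bounded least-squares fits on the kit,
96/96 targets of the patterns `A·(b-fan)(a-fan)·u`, `A E_s B_y E_t·u` and random words have a single feasible atom representative, typically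
10–30 distinct ones per 40 starts), whereas the narrower normal form "one `b`-spoke after an `a`-fan" is FALSE (the spoke weight is a root of a cubic
with no admissible real root in an explicit instance, memo §3).  `HypSet` and `HypAC` are logically independent as stated (weak legs vs. `InKE` legs).
[cite: Grimmett2006, §3.9 eq. (3.94) (pp. 63–64)] [folklore]
-/

noncomputable section

namespace Summit.CriticalPhenomena.PercolationContinuityZ3.Theorems

namespace FK

namespace ThreeApex

/-! ### Letter-stable sets of bivectors (no convexity) -/

/-- A SET of bivectors mapped into itself by the whole letters `∧²E_r`, `∧²AC_x`, `∧²BC_y` (`r, x, y ∈ [0,1]`); no cone structure is asked. [folklore] -/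
@[folklore] structure IsLetterStable (q : ℝ) (K : Set Biv) : Prop where
  /-- `∧²E_r K ⊆ K` -/
  rim : ∀ (r : ℝ) β, 0 ≤ r → r ≤ 1 → β ∈ K → opE q r β ∈ K
  /-- `∧²AC_x K ⊆ K` -/
  ac : ∀ (x : ℝ) β, 0 ≤ x → x ≤ 1 → β ∈ K → opAC x β ∈ K
  /-- `∧²BC_y K ⊆ K` -/
  bc : ∀ (y : ℝ) β, 0 ≤ y → y ≤ 1 → β ∈ K → opBC y β ∈ K

/-- Every letter cone is a letter-stable set. [folklore] -/
theorem IsLetterCone.isLetterStable {q : ℝ} {K : Set Biv} (hK : IsLetterCone q K) : IsLetterStable q K :=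
  ⟨hK.rim, hK.ac, hK.bc⟩

namespace IsLetterStable

variable {q : ℝ} {K : Set Biv}

/-- Rim steps keep the pair bivector in a letter-stable set. [folklore] -/
theorem wedgeH_rimStep_mem (hK : IsLetterStable q K) {r : ℝ} (hr0 : 0 ≤ r) (hr1 : r ≤ 1) {X Y : V5} (h : wedgeH X Y ∈ K) :
    wedgeH (rimStep q r X) (rimStep q r Y) ∈ K := by
  rw [← opE_wedgeH]; exact hK.rim r _ hr0 hr1 h

/-- `a`-spokes keep the pair bivector in a letter-stable set. [folklore] -/
theorem wedgeH_conv_edgeAC_mem (hK : IsLetterStable q K) {x : ℝ} (hx0 : 0 ≤ x) (hx1 : x ≤ 1) {X Y : V5} (h : wedgeH X Y ∈ K) :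
    wedgeH (conv (edgeAC x) X) (conv (edgeAC x) Y) ∈ K := by
  rw [← opAC_wedgeH]; exact hK.ac x _ hx0 hx1 h

/-- `b`-spokes keep the pair bivector in a letter-stable set. [folklore] -/
theorem wedgeH_conv_edgeBC_mem (hK : IsLetterStable q K) {y : ℝ} (hy0 : 0 ≤ y) (hy1 : y ≤ 1) {X Y : V5} (h : wedgeH X Y ∈ K) :
    wedgeH (conv (edgeBC y) X) (conv (edgeBC y) Y) ∈ K := by
  rw [← opBC_wedgeH]; exact hK.bc y _ hy0 hy1 h

/-- **The middle word keeps the pair bivector in a letter-stable set** (blocks with weights in `[0,1]`). [folklore] -/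
theorem wedgeH_midWord_mem (hK : IsLetterStable q K) :
    ∀ {mids : List (ℝ × ℝ × ℝ)}, UnitBlocks mids → ∀ {X Y : V5}, wedgeH X Y ∈ K → wedgeH (midWord q mids X) (midWord q mids Y) ∈ K := by
  intro mids
  induction mids with
  | nil => intro _ X Y h; simpa [midWord] using h
  | cons blk rest ih =>
    intro hm X Y h
    have hb := hm blk (by simp)
    have hrest : UnitBlocks rest := fun b hb' => hm b (by simp [hb'])
    simp only [midWord]
    exact ih hrest (hK.wedgeH_conv_edgeAC_mem hb.2.2.1 hb.2.2.2.1
      (hK.wedgeH_conv_edgeBC_mem hb.2.2.2.2.1 hb.2.2.2.2.2 (hK.wedgeH_rimStep_mem hb.1 hb.2.1 h)))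

end IsLetterStable

/-- **The far cross-apex pair through a letter-stable SET**: if `K ∋ (AC_0∗u) ∧ (AC_1∗u)` is letter-stable and pairs non-negatively with
`(s∗BC_0) ∧ (s∗BC_1)`, then `Z¹¹Z⁰⁰ ≤ Z¹⁰Z⁰¹` for every block list and every last rim weight in `[0,1]`. [folklore] -/
theorem rayleigh_crossFar_of_isLetterStable {q : ℝ} {K : Set Biv} (hK : IsLetterStable q K) {mids : List (ℝ × ℝ × ℝ)} (hm : UnitBlocks mids)
    {rd : ℝ} (hrd0 : 0 ≤ rd) (hrd1 : rd ≤ 1) {u s : V5}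
    (hu : wedgeH (conv (edgeAC 0) u) (conv (edgeAC 1) u) ∈ K)
    (hs : ∀ β, β ∈ K → 0 ≤ pairH q β (wedgeH (conv s (edgeBC 0)) (conv s (edgeBC 1)))) :
    val q (conv s (conv (edgeBC 1) (rimStep q rd (midWord q mids (conv (edgeAC 1) u))))) *
        val q (conv s (conv (edgeBC 0) (rimStep q rd (midWord q mids (conv (edgeAC 0) u))))) ≤
      val q (conv s (conv (edgeBC 0) (rimStep q rd (midWord q mids (conv (edgeAC 1) u))))) *
        val q (conv s (conv (edgeBC 1) (rimStep q rd (midWord q mids (conv (edgeAC 0) u))))) := by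
  have hmem : wedgeH (rimStep q rd (midWord q mids (conv (edgeAC 0) u))) (rimStep q rd (midWord q mids (conv (edgeAC 1) u))) ∈ K :=
    hK.wedgeH_rimStep_mem hrd0 hrd1 (hK.wedgeH_midWord_mem hm hu)
  have key := rayleigh_of_isOpCone hmem hs
  have e : ∀ (τ : ℝ) (X : V5), conv s (conv (edgeBC τ) X) = conv X (conv s (edgeBC τ)) := by
    intro τ X; simp only [← mul_def]; ac_rfl
  simp only [e]
  linarith [key]

/-! ### Linearity of the whole letters in the scalar (`opBC_smul'` is in `…OneSidedConeSDeg`) -/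

/-- `∧²E_r (c•β) = c•∧²E_r β`. [folklore] -/
theorem opE_smul (q r c : ℝ) (β : Biv) : opE q r (Biv.smul c β) = Biv.smul c (opE q r β) := by
  ext <;> simp only [opE, opTD, opWD, formD, Biv.lin3, Biv.add, Biv.smul] <;> ring

/-- `∧²AC_x (c•β) = c•∧²AC_x β`. [folklore] -/
theorem opAC_smul (x c : ℝ) (β : Biv) : opAC x (Biv.smul c β) = Biv.smul c (opAC x β) := by
  ext <;> simp only [opAC, opTa, opWa, Biv.lin3, Biv.add, Biv.smul] <;> ring

/-- `c•(c'•β) = (c c')•β`. [folklore] -/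
theorem Biv.smul_smul' (c c' : ℝ) (β : Biv) : Biv.smul c (Biv.smul c' β) = Biv.smul (c * c') β := by
  ext <;> simp only [Biv.smul] <;> ring

/-- `1•β = β`. [folklore] -/
theorem Biv.one_smul' (β : Biv) : Biv.smul 1 β = β := by
  ext <;> simp only [Biv.smul, one_mul]

/-! ### The atom set: positive multiples of MULTIFAN₁ images with weak legs -/

/-- The weak class of the `a`-leg: masses `≥ 0` and `(U_c)`. [folklore] -/
@[folklore] def LegF (q : ℝ) (F : V5) : Prop := F.Nonneg ∧ UCond q (swapAC F)

/-- The weak class of the input leg: masses `≥ 0` and `(U_b)`. [folklore] -/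
@[folklore] def LegU (q : ℝ) (u : V5) : Prop := u.Nonneg ∧ UCond q (swapAB u)

/-- `InKE` vectors are admissible `a`-legs. [folklore] -/
theorem InKE.legF {q : ℝ} (hq0 : 0 < q) (hq1 : q ≤ 1) {F : V5} (hF : InKE q F) : LegF q F :=
  ⟨(hF.valid hq0.le hq1).nonneg, hF.uCondC hq0 hq1⟩

/-- `InKE` vectors are admissible input legs. [folklore] -/
theorem InKE.legU {q : ℝ} (hq0 : 0 < q) (hq1 : q ≤ 1) {u : V5} (hu : InKE q u) : LegU q u :=
  ⟨(hu.valid hq0.le hq1).nonneg, hu.uCondB hq0 hq1⟩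

/-- **The atom set**: non-negative multiples `c • imgAB q F G u` of MULTIFAN₁ images with `F ∈ LegF`, `G ∈ InS`, `u ∈ LegU`.  Not convex. [folklore] -/
def mfAtomSet (q : ℝ) : Set Biv :=
  {β | ∃ (c : ℝ) (F G u : V5), 0 ≤ c ∧ LegF q F ∧ InS q G ∧ LegU q u ∧ β = Biv.smul c (imgAB q F G u)}

/-- A MULTIFAN₁ image with admissible legs is an atom. [folklore] -/
theorem imgAB_mem_mfAtomSet {q : ℝ} {F G u : V5} (hF : LegF q F) (hG : InS q G) (hu : LegU q u) : imgAB q F G u ∈ mfAtomSet q :=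
  ⟨1, F, G, u, zero_le_one, hF, hG, hu, (Biv.one_smul' _).symm⟩

/-- Non-negative multiples of atoms are atoms. [folklore] -/
theorem smul_mem_mfAtomSet {q c : ℝ} (hc : 0 ≤ c) {β : Biv} (hβ : β ∈ mfAtomSet q) : Biv.smul c β ∈ mfAtomSet q := by
  obtain ⟨c', F, G, u, hc', hF, hG, hu, rfl⟩ := hβ
  exact ⟨c * c', F, G, u, mul_nonneg hc hc', hF, hG, hu, Biv.smul_smul' c c' _⟩

/-- **Inputs are atoms** (`u ∈ InKE q`, `0 < q ≤ 1`): `(AC_0∗u) ∧ (AC_1∗u) = imgAB q fanInit fanInit u`. [folklore] -/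
theorem input_mem_mfAtomSet {q : ℝ} (hq0 : 0 < q) (hq1 : q ≤ 1) {u : V5} (hu : InKE q u) :
    wedgeH (conv (edgeAC 0) u) (conv (edgeAC 1) u) ∈ mfAtomSet q := by
  rw [← imgAB_init]
  exact imgAB_mem_mfAtomSet ((fanInit_inKE q).legF hq0 hq1) ((fanInit_inKE q).inS hq0 hq1) (hu.legU hq0 hq1)

/-- **Targets pair non-negatively with every atom** (`0 < q < 1`, `s ∈ InKE q`) — the MULTIFAN₁ theorem on its weak legs. [folklore] -/
theorem pairH_mfAtomSet_target {q : ℝ} (hq0 : 0 < q) (hq1 : q < 1) {s : V5} (hs : InKE q s) :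
    ∀ β, β ∈ mfAtomSet q → 0 ≤ pairH q β (wedgeH (conv s (edgeBC 0)) (conv s (edgeBC 1))) := by
  rintro β ⟨c, F, G, u, hc, hF, hG, hu, rfl⟩
  rw [pairH_smul_left]
  refine mul_nonneg hc ?_
  have h := mfRay_nonneg_of_goodIJ hq0 hq1 (goodIJ_endpoints hq0.le hq1.le) hF.1 hF.2 hG.valid.nonneg hG.ua hu.1 hu.2
    (hs.valid hq0.le hq1.le).nonneg (hs.uCond hq0 hq1.le)
  rw [mfRay, mfRay_eq_pairH_imgAB] at h
  exact nonneg_of_mul_nonneg_right' (pow_pos hq0 2) h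
where
  /-- `0 < a`, `0 ≤ a * b` ⟹ `0 ≤ b`. [folklore] -/
  nonneg_of_mul_nonneg_right' {a b : ℝ} (ha : 0 < a) (h : 0 ≤ a * b) : 0 ≤ b := by
    by_contra hb; push Not at hb; nlinarith

/-! ### The set-level hypothesis and the reduction -/

/-- **`HypSet`** (set-level `a`-spoke stability): an `a`-spoke maps every MULTIFAN₁ image with admissible legs to a non-negative multiple of a
MULTIFAN₁ image with admissible legs — the oriented plane `AC_x · G_b F_a · span(u, P_a u)` is again a MULTIFAN₁ plane. [folklore] -/
@[folklore] def HypSet (q : ℝ) : Prop :=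
  ∀ (x : ℝ) (F G u : V5), 0 ≤ x → x ≤ 1 → LegF q F → InS q G → LegU q u → opAC x (imgAB q F G u) ∈ mfAtomSet q

/-- **Under `HypSet` the atom set is letter-stable** (`0 < q ≤ 1`): `b`-spokes and rim steps are absorbed into the `b`-leg unconditionally
(`InS` is closed under both), the `a`-spoke by hypothesis. [folklore] -/
theorem isLetterStable_mfAtomSet {q : ℝ} (hq0 : 0 < q) (hq1 : q ≤ 1) (h : HypSet q) : IsLetterStable q (mfAtomSet q) where
  rim := by
    rintro r β hr0 hr1 ⟨c, F, G, u, hc, hF, hG, hu, rfl⟩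
    rw [opE_smul, opE_imgAB]
    exact smul_mem_mfAtomSet hc (imgAB_mem_mfAtomSet hF (hG.rimStep hq0 hq1 hr0 hr1) hu)
  ac := by
    rintro x β hx0 hx1 ⟨c, F, G, u, hc, hF, hG, hu, rfl⟩
    rw [opAC_smul]
    exact smul_mem_mfAtomSet hc (h x F G u hx0 hx1 hF hG hu)
  bc := by
    rintro y β hy0 hy1 ⟨c, F, G, u, hc, hF, hG, hu, rfl⟩
    rw [opBC_smul', opBC_imgAB]
    exact smul_mem_mfAtomSet hc (imgAB_mem_mfAtomSet hF (((IsLetter.bc hy0 hy1).inS hq0 hq1).conv hq0 hq1 hG) hu)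

/-- **`HypSet` ⟹ THE ALGEBRA-LEVEL FAR THEOREM** (`0 < q < 1`): the hypothesis `halg` of `negCorr_spokes_cross_far_of_inKE`, with no cone,
bi-dual or compactness argument — every word image of an input is a non-negative multiple of ONE MULTIFAN₁ image. [folklore] -/
theorem rayleigh_crossFar_of_hypSet {q : ℝ} (hq0 : 0 < q) (hq1 : q < 1) (h : HypSet q) :
    ∀ (mids : List (ℝ × ℝ × ℝ)), UnitBlocks mids → ∀ rd : ℝ, 0 ≤ rd → rd ≤ 1 → ∀ u s : V5, InKE q u → InKE q s →
      0 ≤ crossFarZ q mids rd u s 1 0 * crossFarZ q mids rd u s 0 1 - crossFarZ q mids rd u s 1 1 * crossFarZ q mids rd u s 0 0 := by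
  intro mids hm rd hrd0 hrd1 u s hu hs
  have key := rayleigh_crossFar_of_isLetterStable (isLetterStable_mfAtomSet hq0 hq1.le h) hm hrd0 hrd1 (input_mem_mfAtomSet hq0 hq1.le hu)
    (pairH_mfAtomSet_target hq0 hq1 hs)
  simp only [crossFarZ]
  linarith [key]

open MeasureTheory Literature.Probability.LatticeModels Literature.Probability.Percolation
open scoped Classical

variable {V : Type*} [Fintype V]

section Setting

variable {a b : V} {c : ℕ → V} {m : ℕ}
variable (hab : a ≠ b) (hinj : ∀ j k, j ≤ m → k ≤ m → c j = c k → j = k) (hca : ∀ j, j ≤ m → c j ≠ a) (hcb : ∀ j, j ≤ m → c j ≠ b)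
include hab hinj hca hcb

/-- **`HypSet` ⟹ NEGATIVE CORRELATION OF EVERY CROSS-APEX PAIR AT EVERY DISTANCE** (`0 < q < 1`): for every weighted double fan
(`card V = m + 3`, weights supported on the double-fan pairs) and all `j < k ≤ m`: `φ(J_{a c_j} ∩ J_{b c_k}) ≤ φ(J_{a c_j})·φ(J_{b c_k})`. [folklore] -/
theorem negCorr_spokes_cross_far_of_hypSet (hcard : Fintype.card V = m + 3) {q : ℝ} (hq0 : 0 < q) (hq1 : q < 1)
    (w : Sym2 V → unitInterval) (hsupp : ∀ e, e ∉ dfPairs a b c m → w e = 0) (h : HypSet q) {j k : ℕ} (hjk : j < k) (hk : k ≤ m) :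
    (rcMeasureW w q ∅).real ({ω : BondConfig V | s(a, c j) ∈ ω} ∩ {ω | s(b, c k) ∈ ω}) ≤
      (rcMeasureW w q ∅).real {ω : BondConfig V | s(a, c j) ∈ ω} * (rcMeasureW w q ∅).real {ω : BondConfig V | s(b, c k) ∈ ω} :=
  negCorr_spokes_cross_far_of_inKE hab hinj hca hcb hcard hq0 w hsupp (rayleigh_crossFar_of_hypSet hq0 hq1 h) hjk hk

end Setting

end ThreeApex

end FK

end Summit.CriticalPhenomena.PercolationContinuityZ3.Theorems
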